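import Mathlib.Combinatorics.SimpleGraph.Circulant
import Literature.MathematicalPhysics.QuantumLattice.SpinChargeKinematics
import Literature.Probability.LatticeModels.LatticeGraph
import Literature.Probability.LatticeModels.IsingTorusTransfer
import HarnessLib

/-!
# Exchangeable counts in a spin-½ weight sector, and ordered-pair edge sums on the torus

Elementary (double) counting behind the uniform-trial-state variational bound for hard-core
lattice bosons / spin-½ ferromagnets in a fixed magnetisation sector.

* `sum_edgeFinset_eq_half_sum_sum_boole_mul` — a sum over the edges of a finite simple graph is
  half the sum over ORDERED adjacent pairs, written with the real adjacency indicator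
  `[x ∼ y] = if G.Adj x y then 1 else 0` (weighted handshake); in particular
  `Σ_x Σ_y [x ∼ y] = 2|E|` (`sum_sum_boole_adj_eq_two_mul_card_edgeFinset`).
* `torusGraph_adj_self_add_iff`, `torusGraph_sum_ite_adj_eq` — translations are automorphisms of
  the discrete torus `(ℤ/Lℤ)^d`, so the torus graph is regular: `Σ_w [v ∼ w] c` does not depend
  on the vertex `v`.
* The weight sector `S_w = {σ : Λ → Fin 2 | Σ_z σ_z = w}` of spin-½ configurations (`σ_z = 0` is
  spin up, so `S_w` has `|Λ| - w` up spins) is invariant under site permutations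
  (`weight_comp_equiv`); hence the uniform vector `1_{S_w}` is fixed by every permutation unitary
  (`permOp_mulVec_weightIndicator`), and the uniform measure on `S_w` is EXCHANGEABLE: the one- and
  two-point up-spin counts `Σ_{σ∈S_w} n_x(σ)` and `Σ_{σ∈S_w} n_x(σ) n_y(σ)` (`n_x = 1 - σ_x`,
  `x ≠ y`) do not depend on the sites (`weightSector_sum_up_eq`, `weightSector_sum_upup_eq`), so
  `|Λ| · Σ_{σ∈S_w} n_x = |S_w| (|Λ| - w)` and
  `|Λ|(|Λ| - 1) · Σ_{σ∈S_w} n_x n_y = |S_w| (|Λ| - w)(|Λ| - w - 1)`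
  (`weightSector_sum_up_mul_card`, `weightSector_upup_count`): the hypergeometric moments
  `⟨n_x⟩ = M/V`, `⟨n_x n_y⟩ = M(M-1)/(V(V-1))` of `M = V - w` up spins on `V = |Λ|` sites.

## Sources

All statements are finite counting; folklore. The exchangeability computation of the first two
hypergeometric moments is e.g. W. Feller, *An Introduction to Probability Theory and its
Applications* I (3rd ed.), §IX.5; the weighted handshake lemma is Mathlib's
`SimpleGraph.sum_degrees_eq_twice_card_edges` with weights
(`Literature.Probability.LatticeModels.sum_edgeFinset_eq_half_sum_neighborFinset`).
-/

noncomputable section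

namespace Literature.MathematicalPhysics.QuantumLattice

open scoped BigOperators
open _root_.Matrix _root_.Finset Literature.Probability.LatticeModels

/-! ### Ordered-pair form of edge sums -/

section Graph

variable {V : Type*} [Fintype V] [DecidableEq V] (G : SimpleGraph V) [DecidableRel G.Adj]

/-- **Weighted handshake, ordered-pair form**: `Σ_{e ∈ E} F(e) = ½ Σ_x Σ_y [x ∼ y] F{x,y}` with the
real adjacency indicator `[x ∼ y] = if G.Adj x y then 1 else 0`. [folklore] -/
theorem sum_edgeFinset_eq_half_sum_sum_boole_mul (F : Sym2 V → ℝ) :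
    ∑ e ∈ G.edgeFinset, F e =
      1 / 2 * ∑ x, ∑ y, (if G.Adj x y then (1 : ℝ) else 0) * F s(x, y) := by
  rw [sum_edgeFinset_eq_half_sum_neighborFinset G F]
  congr 1
  refine Finset.sum_congr rfl fun x _ => ?_
  rw [SimpleGraph.neighborFinset_eq_filter, Finset.sum_filter]
  refine Finset.sum_congr rfl fun y _ => ?_
  rw [boole_mul]

/-- The number of ordered adjacent pairs is twice the number of edges, `Σ_x Σ_y [x ∼ y] = 2|E|`.
[folklore] -/
theorem sum_sum_boole_adj_eq_two_mul_card_edgeFinset :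
    ∑ x, ∑ y, (if G.Adj x y then (1 : ℝ) else 0) = 2 * (G.edgeFinset.card : ℝ) := by
  have h := sum_edgeFinset_eq_half_sum_sum_boole_mul G (fun _ => (1 : ℝ))
  simp only [mul_one, Finset.sum_const, nsmul_eq_mul] at h
  linarith

end Graph

/-! ### The torus graph is regular -/

section Torus

variable {d L : ℕ}

/-- Translation invariance of adjacency on the discrete torus `(ℤ/Lℤ)^d`:
`v ∼ v + w ↔ 0 ∼ w` (Mathlib's `SimpleGraph.circulantGraph_adj_translate`). [folklore] -/
theorem torusGraph_adj_self_add_iff (v w : TorusSite d L) :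
    (torusGraph d L).Adj v (v + w) ↔ (torusGraph d L).Adj 0 w := by
  have h := @SimpleGraph.circulantGraph_adj_translate (TorusSite d L) _
    (Set.range fun i : Fin d => (Pi.single i 1 : TorusSite d L)) 0 w v
  rw [zero_add, add_comm w v] at h
  exact h

/-- **The torus graph is regular** (sum form): `Σ_w [v ∼ w] c = Σ_w [0 ∼ w] c` for every vertex
`v` of `(ℤ/Lℤ)^d` — translation by `v` is a graph automorphism. [folklore] -/
theorem torusGraph_sum_ite_adj_eq [NeZero L] (v : TorusSite d L) (c : ℝ) :
    ∑ w, (if (torusGraph d L).Adj v w then c else 0) =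
      ∑ w, (if (torusGraph d L).Adj 0 w then c else 0) := by
  calc ∑ w, (if (torusGraph d L).Adj v w then c else 0)
      = ∑ w, (if (torusGraph d L).Adj v (v + w) then c else 0) :=
        (Fintype.sum_equiv (Equiv.addLeft v) _ _ fun _ => rfl).symm
    _ = ∑ w, (if (torusGraph d L).Adj 0 w then c else 0) := by
        simp only [torusGraph_adj_self_add_iff]

end Torus

/-! ### Exchangeable counts in a weight sector of spin-½ configurations -/

section Sector

variable {Λ : Type*} [Fintype Λ] [DecidableEq Λ]

omit [DecidableEq Λ] in
/-- The weight `Σ_z σ_z` (number of down spins) of a spin-½ configuration is invariant under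
relabelling the sites. [folklore] -/
theorem weight_comp_equiv (e : Λ ≃ Λ) (σ : TensorIndex Λ 2) :
    (∑ z, ((σ (e z) : Fin 2) : ℕ)) = ∑ z, (σ z : ℕ) :=
  Equiv.sum_comp e (fun z => ((σ z : Fin 2) : ℕ))

/-- **The uniform vector of a weight sector is permutation invariant**: every permutation unitary
`permOp e` fixes `1_{S_w}`, `S_w = {σ | Σ_z σ_z = w}`. [folklore] -/
theorem permOp_mulVec_weightIndicator (e : Λ ≃ Λ) (w : ℕ) :
    (permOp e : Op Λ 2) *ᵥ (fun σ => if (∑ z, (σ z : ℕ)) = w then (1 : ℂ) else 0) =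
      fun σ => if (∑ z, (σ z : ℕ)) = w then (1 : ℂ) else 0 := by
  rw [permOp_mulVec]
  funext σ
  simp only [weight_comp_equiv]

/-- **One-point exchangeability** of the uniform measure on a weight sector: the up-spin count
`Σ_{σ ∈ S_w} (1 - σ_x)` does not depend on the site `x` (transport by the transposition of `x` and
`x'`). [folklore] -/
theorem weightSector_sum_up_eq (w : ℕ) (x x' : Λ) :
    ∑ σ : TensorIndex Λ 2, (if (∑ z, (σ z : ℕ)) = w then (1 : ℝ) else 0) * (1 - ((σ x : ℕ) : ℝ)) =
      ∑ σ : TensorIndex Λ 2,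
        (if (∑ z, (σ z : ℕ)) = w then (1 : ℝ) else 0) * (1 - ((σ x' : ℕ) : ℝ)) := by
  refine Fintype.sum_equiv (configPerm (q := 2) (Equiv.swap x x')) _ _ fun σ => ?_
  simp only [configPerm_apply, weight_comp_equiv, Equiv.swap_apply_right]

/-- The first hypergeometric moment: `|Λ| · Σ_{σ ∈ S_w} (1 - σ_x) = |S_w| · (|Λ| - w)` (sum the
exchangeable one-point counts over the sites; a configuration of weight `w` has `|Λ| - w` up
spins). [folklore] -/
theorem weightSector_sum_up_mul_card (w : ℕ) (x : Λ) :
    (Fintype.card Λ : ℝ) *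
        ∑ σ : TensorIndex Λ 2, (if (∑ z, (σ z : ℕ)) = w then (1 : ℝ) else 0) * (1 - ((σ x : ℕ) : ℝ)) =
      (∑ σ : TensorIndex Λ 2, (if (∑ z, (σ z : ℕ)) = w then (1 : ℝ) else 0)) *
        ((Fintype.card Λ : ℝ) - w) := by
  have h1 : (Fintype.card Λ : ℝ) *
      ∑ σ : TensorIndex Λ 2, (if (∑ z, (σ z : ℕ)) = w then (1 : ℝ) else 0) * (1 - ((σ x : ℕ) : ℝ)) =
      ∑ x' : Λ, ∑ σ : TensorIndex Λ 2,
        (if (∑ z, (σ z : ℕ)) = w then (1 : ℝ) else 0) * (1 - ((σ x' : ℕ) : ℝ)) := by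
    rw [Finset.sum_congr rfl fun x' _ => weightSector_sum_up_eq w x' x, Finset.sum_const,
      Finset.card_univ, nsmul_eq_mul]
  rw [h1, Finset.sum_comm, Finset.sum_mul]
  refine Finset.sum_congr rfl fun σ _ => ?_
  rw [← Finset.mul_sum]
  by_cases hσ : (∑ z, (σ z : ℕ)) = w
  · rw [if_pos hσ, Finset.sum_sub_distrib, Finset.sum_const, Finset.card_univ, nsmul_eq_mul,
      mul_one, ← hσ]
    push_cast
    ring
  · rw [if_neg hσ, zero_mul, zero_mul]

/-- **Two-point exchangeability** of the uniform measure on a weight sector: for a fixed site `x`,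
the pair count `Σ_{σ ∈ S_w} (1 - σ_x)(1 - σ_y)` is the same for all sites `y ≠ x` (transport by
the transposition of `y` and `y'`, which fixes `x`). [folklore] -/
theorem weightSector_sum_upup_eq (w : ℕ) {x y y' : Λ} (hy : y ≠ x) (hy' : y' ≠ x) :
    ∑ σ : TensorIndex Λ 2, (if (∑ z, (σ z : ℕ)) = w then (1 : ℝ) else 0) *
        ((1 - ((σ x : ℕ) : ℝ)) * (1 - ((σ y : ℕ) : ℝ))) =
      ∑ σ : TensorIndex Λ 2, (if (∑ z, (σ z : ℕ)) = w then (1 : ℝ) else 0) *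
        ((1 - ((σ x : ℕ) : ℝ)) * (1 - ((σ y' : ℕ) : ℝ))) := by
  refine Fintype.sum_equiv (configPerm (q := 2) (Equiv.swap y y')) _ _ fun σ => ?_
  simp only [configPerm_apply, weight_comp_equiv, Equiv.swap_apply_right,
    Equiv.swap_apply_of_ne_of_ne hy.symm hy'.symm]

/-- **The second hypergeometric moment** (two-point count in a weight sector): for `x ≠ y`,
`|Λ|(|Λ| - 1) · Σ_{σ ∈ S_w} (1 - σ_x)(1 - σ_y) = |S_w| · (|Λ| - w)(|Λ| - w - 1)`, i.e. a uniformly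
random configuration with `M = |Λ| - w` up spins has both `x` and `y` up with probability
`M(M-1)/(|Λ|(|Λ|-1))`. Proof by exchangeability: summing the pair count over `y` gives
`(M - 1)` times the one-point count, which is `|S_w| M/|Λ|`. [folklore] -/
theorem weightSector_upup_count (w : ℕ) {x y : Λ} (hxy : x ≠ y) :
    (Fintype.card Λ : ℝ) * ((Fintype.card Λ : ℝ) - 1) *
        ∑ σ : TensorIndex Λ 2, (if (∑ z, (σ z : ℕ)) = w then (1 : ℝ) else 0) *
          ((1 - ((σ x : ℕ) : ℝ)) * (1 - ((σ y : ℕ) : ℝ))) =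
      (∑ σ : TensorIndex Λ 2, (if (∑ z, (σ z : ℕ)) = w then (1 : ℝ) else 0)) *
        (((Fintype.card Λ : ℝ) - w) * ((Fintype.card Λ : ℝ) - w - 1)) := by
  set C₁ : ℝ := ∑ σ : TensorIndex Λ 2,
    (if (∑ z, (σ z : ℕ)) = w then (1 : ℝ) else 0) * (1 - ((σ x : ℕ) : ℝ)) with hC₁
  set C₂ : Λ → ℝ := fun y' => ∑ σ : TensorIndex Λ 2, (if (∑ z, (σ z : ℕ)) = w then (1 : ℝ) else 0) *
    ((1 - ((σ x : ℕ) : ℝ)) * (1 - ((σ y' : ℕ) : ℝ))) with hC₂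
  -- (i) the diagonal term: `(1 - σ_x)² = 1 - σ_x`
  have hsq : ∀ k : Fin 2, ((1 : ℝ) - (k : ℕ)) * (1 - (k : ℕ)) = 1 - (k : ℕ) := by
    intro k
    fin_cases k <;> norm_num
  have hxx : C₂ x = C₁ := by
    simp only [hC₂, hC₁, hsq]
  -- (ii) exchangeability in the second site
  have hC₂eq : ∀ y', y' ≠ x → C₂ y' = C₂ y := fun y' hy' =>
    weightSector_sum_upup_eq w hy' hxy.symm
  -- (iii) summing the pair count over the second site
  have hsum : ∑ y', C₂ y' = ((Fintype.card Λ : ℝ) - w) * C₁ := by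
    simp only [hC₂, hC₁]
    rw [Finset.sum_comm, Finset.mul_sum]
    refine Finset.sum_congr rfl fun σ _ => ?_
    rw [← Finset.mul_sum, ← Finset.mul_sum]
    by_cases hσ : (∑ z, (σ z : ℕ)) = w
    · rw [if_pos hσ, Finset.sum_sub_distrib, Finset.sum_const, Finset.card_univ, nsmul_eq_mul,
        mul_one, ← hσ]
      push_cast
      ring
    · rw [if_neg hσ, zero_mul, zero_mul, mul_zero]
  -- (iv) the same sum, split into `y' = x` and the `|Λ| - 1` sites `y' ≠ x`
  have hsplit : ∑ y', C₂ y' = C₁ + ((Fintype.card Λ : ℝ) - 1) * C₂ y := by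
    rw [← Finset.add_sum_erase _ _ (Finset.mem_univ x), hxx,
      Finset.sum_congr rfl fun y' hy' => hC₂eq y' (Finset.ne_of_mem_erase hy'), Finset.sum_const,
      Finset.card_erase_of_mem (Finset.mem_univ x), Finset.card_univ, nsmul_eq_mul,
      Nat.cast_pred (Fintype.card_pos_iff.2 ⟨x⟩)]
  -- (v) combine with the first moment
  have hone := weightSector_sum_up_mul_card (Λ := Λ) w x
  rw [← hC₁] at hone
  have e1 : C₁ + ((Fintype.card Λ : ℝ) - 1) * C₂ y = ((Fintype.card Λ : ℝ) - w) * C₁ :=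
    hsplit.symm.trans hsum
  show (Fintype.card Λ : ℝ) * ((Fintype.card Λ : ℝ) - 1) * C₂ y = _
  linear_combination (Fintype.card Λ : ℝ) * e1 + ((Fintype.card Λ : ℝ) - w - 1) * hone

end Sector

end Literature.MathematicalPhysics.QuantumLattice

end
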